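import Summits.RiemannHypothesis.RiemannHypothesis.Theorems.Splittings.LiDescentZeroPositiveLaw
import Summits.RiemannHypothesis.RiemannHypothesis.Theorems.Splittings.LiSecondOrderCriterion
import HarnessLib

/-!
# The DESCENT COUNTING LAW of the Keiper–Li sequence under RH (SketchG8 §§1–3)

Cell rh-split, seat rh-split-li-bridge g8 (brief sha16 f79c5f09d8bcb036), card `run/shared/lean/pub/rh-split/cards/SPLIT-li-bridge.md` §15;
kernel source `HOME/rh-split-li-bridge/SketchG8.lean` sha16 7af98f60a743c35d (672 l, farm rc 0, std axioms), cut by the seat at the scratch's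
section boundaries, decl text byte-verbatim; deltas = namespace `RhSplit.LiBridgeG8` ↦ `…Theorems.Splittings.LiDescentCountingLaw`, imports,
module docstrings.  Tree inputs only: lane (xi)(c)–(f) (`LiLowZeroBudget.blockLaw_budget_clause`, `LiIncrHighPart.highPart_lower`,
`LiIncrBlockLawOfRH.lowSum_eq/reindex_nat/eventually_sqrt_log_le`, `LiIncrBlockLaw.TLi3.card_neg_mul_sq_le`, `LiIncrMeanSquare.MeanSquare.sum_sq_le'`),
Part Z (`LiDescentZeroPositiveLaw`), and the curvature band of `LiSecondOrderCriterion` (`liIncr_le_of_exception`).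

This file (`D = {n : λ_{n+1} < λ_n}` the descent set, blocks `[N, 2N)`): §1 `blockLaw_sharp_of_rh` — RH ⟹ the block law of the tree's
`blockLaw_of_RH` (`Δ_n = P(n) + Σ_j a_j sin((n+½)θ_j)`, `P ≥ (1/10)·log N`) with the budget clause SHARPENED from `C·N·log N` to `C·N`
(same witnesses; `blockLaw_budget_clause (lam := 1)` in place of its `_log` weakening); §2 `card_liDescent_block_le_of_rh` — RH ⟹
`#(D ∩ [N,2N)) ≤ C·N/(log N)²` for `N ≥ N₀` (Chebyshev against the engine's mean square); §3 `cumulative_of_dyadic` (PURE: a dyadic-block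
bound `C·N/(log N)²` for a decidable predicate integrates to `(6C+1)·N/(log N)²` for `#{n < N}`), helpers `dyadic_step_ineq`,
`card_range_filter_mono`, `card_range_double_le`, and `card_liDescent_le_of_rh` — RH ⟹ `∃ C, ∀ᶠ N, #(D ∩ [0,N)) ≤ C·N/(log N)²`.
RH-IMPLIED kernel estimates + one pure counting lemma; no RH-equivalence is asserted in this file; certifies nothing about RH.

HONEST LABEL: «SPLITTING SEARCH over kernel-typed RH-EQUIVALENCES; a splitting A ∧ B ⟹ RH is CONDITIONAL bookkeeping unless A and B are
both proved; nothing here bears on the truth of RH.»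
-/

set_option linter.dupNamespace false

noncomputable section

namespace Summit.RiemannHypothesis.RiemannHypothesis.Theorems.Splittings.LiDescentCountingLaw

open Filter Topology Finset
open Literature.NumberTheory.LFunctions Literature.NumberTheory.LFunctions.SchoenfeldBound
open Summit.RiemannHypothesis.RiemannHypothesis.Theorems.LiTheory
open Summit.RiemannHypothesis.RiemannHypothesis.Theorems.Splittings.LiLowZeroBudget
  (ampM phase phase_mem fourteen_lt_im blockLaw_budget_clause)
open Summit.RiemannHypothesis.RiemannHypothesis.Theorems.Splittings.LiIncrMeanSquare.MeanSquare
  (dirichletBound sum_sq_le')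
open Summit.RiemannHypothesis.RiemannHypothesis.Theorems.Splittings.LiIncrBlockLaw (TLi3.card_neg_mul_sq_le)
open Summit.RiemannHypothesis.RiemannHypothesis.Theorems.Splittings.LiIncrHighPart
  (liIncr highPart lowSum liIncr_eq_highPart_add_lowSum highPart_lower)
open Summit.RiemannHypothesis.RiemannHypothesis.Theorems.Splittings.LiIncrBlockLawOfRH
  (reindex_nat lowSum_eq eventually_sqrt_log_le)
open Summit.RiemannHypothesis.RiemannHypothesis.Theorems.Splittings.LiDescentZeroPositiveLaw
  (rh_iff_liDescent_densityZero liDescent_lower_density_of_not_rh)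
open Summit.RiemannHypothesis.RiemannHypothesis.Theorems.Splittings.LiSecondOrderCriterion
  (abs_liSecondDiff_le_of_rh liIncr_le_of_exception)

/-! ## §1 The SHARP block law under RH (budget `C·N`, margin `(1/10)·log N`) -/

/-- **RH ⟹ sharp block law.** For `N ≥ N₀`: `Δ_n = P(n) + Σ_{j<m} a_j sin((n+½)θ_j)` on `[N, 2N)` with
`θ_j ∈ (0, π/2]`, `P(n) ≥ (1/10) log N`, and `Σ_{j,k} |a_j||a_k| D_N(θ_j − θ_k) ≤ C·N`.
(Proof = the tree's `blockLaw_of_RH` verbatim with `blockLaw_budget_clause` in place of its `_log` weakening.) -/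
theorem blockLaw_sharp_of_rh (hRH : RiemannHypothesis) :
    ∃ C : ℝ, 0 ≤ C ∧ ∃ N₀ : ℕ, ∀ N : ℕ, N₀ ≤ N → 2 ≤ N ∧
      ∃ (s : Finset ℕ) (a θ : ℕ → ℝ) (P : ℕ → ℝ),
        (∀ j ∈ s, 0 < θ j ∧ θ j ≤ Real.pi / 2) ∧
        (∀ n ∈ Finset.Ico N (N + N),
          (keiperLiCoeff (n + 1) - keiperLiCoeff n) =
            P n + ∑ j ∈ s, a j * Real.sin (((n : ℝ) + 1 / 2) * θ j)) ∧
        (∀ n ∈ Finset.Ico N (N + N), 1 / 10 * Real.log N ≤ P n) ∧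
        (∑ j ∈ s, ∑ k ∈ s, |a j| * |a k| * dirichletBound N (θ j - θ k) ≤ C * N) := by
  obtain ⟨C, hC0, hC⟩ := blockLaw_budget_clause (lam := 1) le_rfl
  have hev : ∀ᶠ N : ℕ in atTop, (4 * Real.sqrt N * (Real.log (2 * (N : ℝ)) + 2) ≤ N ∧
      250 ≤ Real.log (N : ℝ)) ∧ 900 ≤ N :=
    (eventually_sqrt_log_le.and
      ((Real.tendsto_log_atTop.comp tendsto_natCast_atTop_atTop).eventually_ge_atTop 250)).and
      (eventually_ge_atTop 900)
  obtain ⟨N₀, hN₀⟩ := Filter.eventually_atTop.1 hev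
  refine ⟨C, hC0, N₀, fun N hN ↦ ?_⟩
  obtain ⟨⟨hE2, hE3⟩, hE1⟩ := hN₀ N hN
  refine ⟨by omega, ?_⟩
  set Y : ℝ := Real.sqrt N with hYdef
  have hNr : (900 : ℝ) ≤ N := by exact_mod_cast hE1
  have hN0 : (0 : ℝ) < N := by linarith
  have hY30 : 30 ≤ Y :=
    calc (30 : ℝ) = Real.sqrt (30 ^ 2) := (Real.sqrt_sq (by norm_num)).symm
      _ ≤ Real.sqrt N := Real.sqrt_le_sqrt (by linarith)
  have hY0 : 0 ≤ Y := by linarith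
  have hY2 : Y ^ 2 = N := by rw [hYdef, Real.sq_sqrt hN0.le]
  obtain ⟨m, σ, hσ, hsum⟩ := reindex_nat (zerosBetween 0 Y)
  refine ⟨Finset.range m, fun j ↦ ampM (σ j), fun j ↦ phase (σ j), fun n ↦ highPart n Y,
    ?_, ?_, ?_, ?_⟩
  · intro j hj
    exact phase_mem (fourteen_lt_im (hσ j hj))
  · intro n _
    dsimp only
    rw [hsum (fun ρ ↦ ampM ρ * Real.sin (((n : ℝ) + 1 / 2) * phase ρ)), ← lowSum_eq]
    exact liIncr_eq_highPart_add_lowSum n Y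
  · intro n hn
    rw [Finset.mem_Ico] at hn
    obtain ⟨hNn, hn2⟩ := hn
    have hn1 : 1 ≤ n := by omega
    have hnr : (N : ℝ) ≤ n := by exact_mod_cast hNn
    have hn2r : (n : ℝ) + 1 ≤ 2 * N := by exact_mod_cast (by omega : n + 1 ≤ 2 * N)
    have hlogn1 : Real.log ((n : ℝ) + 1) ≤ Real.log (2 * (N : ℝ)) :=
      Real.log_le_log (by positivity) hn2r
    have hcond : 4 * Y * (Real.log ((n : ℝ) + 1) + 2) ≤ n :=
      calc 4 * Y * (Real.log ((n : ℝ) + 1) + 2) ≤ 4 * Y * (Real.log (2 * (N : ℝ)) + 2) :=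
            mul_le_mul_of_nonneg_left (by linarith) (by positivity)
        _ ≤ N := hE2
        _ ≤ n := hnr
    have hβ := highPart_lower hRH hn1 hY30 hcond
    have hlogY : Real.log Y = Real.log N / 2 := by rw [hYdef, Real.log_sqrt hN0.le]
    have hlogn : Real.log N ≤ Real.log n := Real.log_le_log hN0 hnr
    have hlogN0 : 0 ≤ Real.log (N : ℝ) := Real.log_nonneg (by linarith)
    rw [hlogY, hY2] at hβ
    have hfrac : (n : ℝ) * (0.34 * (Real.log N / 2) + 3.5) / N ≤
        2 * (0.34 * (Real.log N / 2) + 3.5) := by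
      rw [div_le_iff₀ hN0]
      have := mul_le_mul_of_nonneg_right (by linarith : (n : ℝ) ≤ 2 * N)
        (by positivity : (0 : ℝ) ≤ 0.34 * (Real.log N / 2) + 3.5)
      linarith
    show 1 / 10 * Real.log N ≤ highPart n Y
    linarith
  · calc ∑ j ∈ Finset.range m, ∑ k ∈ Finset.range m,
          |ampM (σ j)| * |ampM (σ k)| * dirichletBound N (phase (σ j) - phase (σ k))
        = ∑ j ∈ Finset.range m, ∑ ρ' ∈ zerosBetween 0 Y,
            |ampM (σ j)| * |ampM ρ'| * dirichletBound N (phase (σ j) - phase ρ') :=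
          Finset.sum_congr rfl fun j _ ↦
            hsum (fun ρ' ↦ |ampM (σ j)| * |ampM ρ'| * dirichletBound N (phase (σ j) - phase ρ'))
      _ = ∑ ρ ∈ zerosBetween 0 Y, ∑ ρ' ∈ zerosBetween 0 Y,
            |ampM ρ| * |ampM ρ'| * dirichletBound N (phase ρ - phase ρ') :=
          hsum (fun ρ ↦ ∑ ρ' ∈ zerosBetween 0 Y,
            |ampM ρ| * |ampM ρ'| * dirichletBound N (phase ρ - phase ρ'))
      _ ≤ C * N := (hC N Y (by omega) hY0 (by rw [hY2, one_mul])).2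

/-! ## §2 THE DESCENT COUNTING LAW (dyadic form): RH ⟹ `#(D ∩ [N,2N)) ≤ C·N/(log N)²` -/

open Classical in
/-- **RH ⟹ at most `C·N/(log N)²` descents `λ_{n+1} < λ_n` in every large dyadic block `[N, 2N)`.**
(Chebyshev `TLi3.card_neg_mul_sq_le` with margin `(1/10) log N` + the engine `sum_sq_le'` + the sharp budget `C·N`;
the constant is `100·C`.)  The descent set is spelled as in Part Z: `{n : ℕ | keiperLiCoeff (n+1) < keiperLiCoeff n}`. -/
theorem card_liDescent_block_le_of_rh (hRH : RiemannHypothesis) :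
    ∃ C : ℝ, 0 ≤ C ∧ ∃ N₀ : ℕ, ∀ N : ℕ, N₀ ≤ N →
      ((((Finset.Ico N (N + N)).filter
          (fun n ↦ n ∈ {n : ℕ | keiperLiCoeff (n + 1) < keiperLiCoeff n})).card : ℕ) : ℝ)
        ≤ C * N / Real.log N ^ 2 := by
  obtain ⟨C, hC0, N₀, hblk⟩ := blockLaw_sharp_of_rh hRH
  refine ⟨100 * C, by positivity, N₀, fun N hN ↦ ?_⟩
  obtain ⟨hN2, s, a, θ, P, hθ, hdec, hP, hW⟩ := hblk N hN
  have hN1 : (1 : ℝ) < N := by exact_mod_cast hN2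
  have hlog : 0 < Real.log N := Real.log_pos hN1
  have hm : 0 < 1 / 10 * Real.log N := by positivity
  have h1 := TLi3.card_neg_mul_sq_le (Δ := fun n ↦ keiperLiCoeff (n + 1) - keiperLiCoeff n) (P := P)
    (F := fun n ↦ ∑ j ∈ s, a j * Real.sin (((n : ℝ) + 1 / 2) * θ j)) hm hdec hP
  have h2 := sum_sq_le' s a θ hθ N (M := N) (by omega)
  have h3 := h1.trans (h2.trans hW)
  have hset : (Finset.Ico N (N + N)).filter (fun n ↦ n ∈ {n : ℕ | keiperLiCoeff (n + 1) < keiperLiCoeff n})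
      = (Finset.Ico N (N + N)).filter (fun n ↦ keiperLiCoeff (n + 1) - keiperLiCoeff n < 0) := by
    refine Finset.filter_congr fun n _ ↦ ?_
    rw [Set.mem_setOf_eq]
    constructor <;> intro h <;> linarith
  rw [hset]
  have e : 100 * C * N / Real.log N ^ 2 = C * N / (1 / 10 * Real.log N) ^ 2 := by
    field_simp
    ring
  rw [e, le_div_iff₀ (by positivity)]
  simpa using h3

/-! ## §3 THE DESCENT COUNTING LAW (cumulative form): RH ⟹ `#(D ∩ [0,N)) ≤ C·N/(log N)²` eventually -/

/-- Numerical core of the dyadic summation: for `L ≥ 3.4657` (`≤ log 32`) and `0 ≤ l ≤ 0.69315` (`≥ log 2`),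
`4 (L + l)² ≤ 6 L²` (i.e. `4/L² ≤ 6/(L+l)²`). -/
theorem dyadic_step_ineq {L l : ℝ} (hL : 3.4657 ≤ L) (hl0 : 0 ≤ l) (hl : l ≤ 0.69315) :
    4 * (L + l) ^ 2 ≤ 6 * L ^ 2 := by
  nlinarith [mul_nonneg (sub_nonneg.2 hL) (sub_nonneg.2 hL), mul_nonneg (sub_nonneg.2 hL) hl0,
    mul_nonneg (sub_nonneg.2 hL) (sub_nonneg.2 hl), mul_nonneg hl0 (sub_nonneg.2 hl)]

/-- Monotonicity of the cumulative count (pure). -/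
theorem card_range_filter_mono {A B : ℕ} (hAB : A ≤ B) (p : ℕ → Prop) [DecidablePred p] :
    ((Finset.range A).filter p).card ≤ ((Finset.range B).filter p).card :=
  Finset.card_le_card (Finset.filter_subset_filter _ (Finset.range_mono hAB))

/-- Splitting the cumulative count at a dyadic step (pure): `#([0,2M) ∩ E) ≤ #([0,M) ∩ E) + #([M,2M) ∩ E)`. -/
theorem card_range_double_le (M : ℕ) (p : ℕ → Prop) [DecidablePred p] :
    ((Finset.range (M + M)).filter p).card ≤
      ((Finset.range M).filter p).card + ((Finset.Ico M (M + M)).filter p).card := by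
  have e : Finset.range (M + M) = Finset.range M ∪ Finset.Ico M (M + M) := by
    rw [Finset.range_eq_Ico, Finset.range_eq_Ico, Finset.Ico_union_Ico_eq_Ico (by omega) (by omega)]
  rw [e, Finset.filter_union]
  exact Finset.card_union_le _ _

/-- **Dyadic-to-cumulative counting (pure):** if `#([N,2N) ∩ E) ≤ C·N/(log N)²` for `N ≥ N₀`, then
`#([0,N) ∩ E) ≤ (6C+1)·N/(log N)²` for all large `N`. (Induction along `N₁·2^k`, `N₁ = max(N₀, 32)`, with the
numerical step `dyadic_step_ineq`; a general `N` is sandwiched between consecutive scales; the additive constant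
`N₁` is absorbed using `log² N / N → 0`.) -/
theorem cumulative_of_dyadic (p : ℕ → Prop) [DecidablePred p] {C : ℝ} (hC0 : 0 ≤ C) {N₀ : ℕ}
    (hblk : ∀ N : ℕ, N₀ ≤ N →
      ((((Finset.Ico N (N + N)).filter p).card : ℕ) : ℝ) ≤ C * N / Real.log N ^ 2) :
    ∀ᶠ N : ℕ in atTop,
      ((((Finset.range N).filter p).card : ℕ) : ℝ) ≤ (6 * C + 1) * N / Real.log N ^ 2 := by
  -- base scale `N₁ = max(N₀, 32)`
  set N₁ : ℕ := max N₀ 32 with hN₁def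
  have hN₁0 : N₀ ≤ N₁ := le_max_left _ _
  have hN₁32 : 32 ≤ N₁ := le_max_right _ _
  have hlog2 : Real.log 2 ≤ 0.69315 := by linarith [Real.log_two_lt_d9]
  have hlog2' : 0.69314718 ≤ Real.log 2 := by linarith [Real.log_two_gt_d9]
  have hlog32 : 3.4657 ≤ Real.log (32 : ℝ) := by
    rw [show (32 : ℝ) = 2 ^ 5 by norm_num, Real.log_pow]
    push_cast
    linarith
  -- the count along the dyadic scales `N₁ · 2^k`
  have key : ∀ k : ℕ,
      ((((Finset.range (N₁ * 2 ^ k)).filter p).card : ℕ) : ℝ) ≤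
        N₁ + 3 * C * ((N₁ * 2 ^ k : ℕ) : ℝ) / Real.log ((N₁ * 2 ^ k : ℕ) : ℝ) ^ 2 := by
    intro k
    induction k with
    | zero =>
      have h1 : ((((Finset.range (N₁ * 2 ^ 0)).filter p).card : ℕ) : ℝ) ≤ N₁ := by
        have h := Finset.card_filter_le (Finset.range (N₁ * 2 ^ 0)) p
        rw [Finset.card_range, pow_zero, mul_one] at h
        have h' : ((((Finset.range (N₁ * 2 ^ 0)).filter p).card : ℕ) : ℝ) ≤ ((N₁ : ℕ) : ℝ) := by
          rw [pow_zero, mul_one]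
          exact_mod_cast h
        exact h'
      have h2 : 0 ≤ 3 * C * ((N₁ * 2 ^ 0 : ℕ) : ℝ) / Real.log ((N₁ * 2 ^ 0 : ℕ) : ℝ) ^ 2 := by
        positivity
      exact h1.trans (le_add_of_nonneg_right h2)
    | succ k ih =>
      set M : ℕ := N₁ * 2 ^ k with hMdef
      have hM2 : N₁ * 2 ^ (k + 1) = M + M := by rw [hMdef, pow_succ]; ring
      have hMN₀ : N₀ ≤ M :=
        hN₁0.trans (by rw [hMdef]; exact Nat.le_mul_of_pos_right _ (by positivity))
      have hM32 : 32 ≤ M :=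
        hN₁32.trans (by rw [hMdef]; exact Nat.le_mul_of_pos_right _ (by positivity))
      have hMr : (32 : ℝ) ≤ M := by exact_mod_cast hM32
      have hM0 : (0 : ℝ) < M := by linarith
      have hstep := card_range_double_le M p
      have hblock := hblk M hMN₀
      have hLM : 3.4657 ≤ Real.log (M : ℝ) := hlog32.trans (Real.log_le_log (by norm_num) hMr)
      have hL0 : 0 < Real.log (M : ℝ) := by linarith
      have hlog2M : Real.log ((M + M : ℕ) : ℝ) = Real.log M + Real.log 2 := by
        push_cast
        rw [← two_mul, Real.log_mul two_ne_zero hM0.ne', add_comm]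
      have hineq := dyadic_step_ineq hLM (by linarith) hlog2
      rw [hM2]
      have hcast : ((((Finset.range (M + M)).filter p).card : ℕ) : ℝ) ≤
          ((((Finset.range M).filter p).card : ℕ) : ℝ) +
            ((((Finset.Ico M (M + M)).filter p).card : ℕ) : ℝ) := by
        exact_mod_cast hstep
      have hsum : ((((Finset.range (M + M)).filter p).card : ℕ) : ℝ) ≤
          N₁ + 4 * C * M / Real.log (M : ℝ) ^ 2 := by
        have : 3 * C * (M : ℝ) / Real.log (M : ℝ) ^ 2 + C * M / Real.log M ^ 2
            = 4 * C * M / Real.log (M : ℝ) ^ 2 := by ring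
        linarith [ih, hblock]
      have hfin : 4 * C * (M : ℝ) / Real.log (M : ℝ) ^ 2 ≤
          3 * C * ((M + M : ℕ) : ℝ) / Real.log ((M + M : ℕ) : ℝ) ^ 2 := by
        rw [hlog2M]
        push_cast
        have hpos : 0 < (Real.log (M : ℝ) + Real.log 2) ^ 2 := by positivity
        rw [div_le_div_iff₀ (by positivity) hpos]
        have hCM : 0 ≤ C * (M : ℝ) := by positivity
        nlinarith [mul_le_mul_of_nonneg_left hineq hCM]
      linarith
  -- `log² N / N → 0`, so `N₁ · (log N)² ≤ N` eventually
  have hsmall : ∀ᶠ N : ℕ in atTop, (N₁ : ℝ) * Real.log N ^ 2 ≤ N := by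
    have h1 : Tendsto (fun x : ℝ ↦ Real.log x ^ 2 / (1 * x + 0)) atTop (𝓝 0) :=
      Real.tendsto_pow_log_div_mul_add_atTop 1 0 2 one_ne_zero
    have h2 := (h1.comp tendsto_natCast_atTop_atTop).eventually
      (gt_mem_nhds (show (0 : ℝ) < 1 / (N₁ + 1) by positivity))
    filter_upwards [h2, eventually_ge_atTop 1] with N hN hN1
    have hN0 : (0 : ℝ) < N := by exact_mod_cast hN1
    simp only [Function.comp, one_mul, add_zero] at hN
    rw [div_lt_div_iff₀ hN0 (by positivity)] at hN
    nlinarith [sq_nonneg (Real.log (N : ℝ)), hN]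
  filter_upwards [hsmall, eventually_ge_atTop (max N₁ 2)] with N hNs hNge
  have hNN₁ : N₁ ≤ N := (le_max_left _ _).trans hNge
  have hN2 : 2 ≤ N := (le_max_right _ _).trans hNge
  have hN₁pos : 0 < N₁ := by omega
  -- pick k with `N₁·2^k ≤ N < N₁·2^(k+1)`
  set k : ℕ := Nat.log 2 (N / N₁) with hkdef
  have hq : 1 ≤ N / N₁ := (Nat.le_div_iff_mul_le hN₁pos).2 (by simpa using hNN₁)
  have hk1 : 2 ^ k ≤ N / N₁ := Nat.pow_log_le_self 2 (by omega)
  have hk2 : N / N₁ < 2 ^ (k + 1) := Nat.lt_pow_succ_log_self (by norm_num) _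
  have hlow : N₁ * 2 ^ k ≤ N := by
    have := (Nat.le_div_iff_mul_le hN₁pos).1 hk1
    rwa [mul_comm] at this
  have hupp : N < N₁ * 2 ^ (k + 1) := by
    have := (Nat.div_lt_iff_lt_mul hN₁pos).1 hk2
    rwa [mul_comm] at this
  have hmono := card_range_filter_mono hupp.le p
  have hK := key (k + 1)
  set B : ℕ := N₁ * 2 ^ (k + 1) with hBdef
  have hB2N : (B : ℝ) ≤ 2 * N := by
    have : B ≤ 2 * N := by
      rw [hBdef, pow_succ]
      calc N₁ * (2 ^ k * 2) = (N₁ * 2 ^ k) * 2 := by ring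
        _ ≤ N * 2 := Nat.mul_le_mul_right 2 hlow
        _ = 2 * N := by ring
    exact_mod_cast this
  have hNr : (2 : ℝ) ≤ N := by exact_mod_cast hN2
  have hN0 : (0 : ℝ) < N := by linarith
  have hNB : (N : ℝ) ≤ B := by exact_mod_cast hupp.le
  have hlogN : 0 < Real.log (N : ℝ) := Real.log_pos (by linarith)
  have hlogNB : Real.log (N : ℝ) ≤ Real.log (B : ℝ) := Real.log_le_log hN0 hNB
  have hfrac : 3 * C * (B : ℝ) / Real.log (B : ℝ) ^ 2 ≤ 6 * C * N / Real.log (N : ℝ) ^ 2 := by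
    have hlogB : 0 < Real.log (B : ℝ) := lt_of_lt_of_le hlogN hlogNB
    rw [div_le_div_iff₀ (by positivity) (by positivity)]
    have h1 : Real.log (N : ℝ) ^ 2 ≤ Real.log (B : ℝ) ^ 2 := by nlinarith
    have h2 : 3 * C * (B : ℝ) ≤ 6 * C * N := by nlinarith
    calc 3 * C * (B : ℝ) * Real.log (N : ℝ) ^ 2 ≤ 6 * C * N * Real.log (N : ℝ) ^ 2 :=
          mul_le_mul_of_nonneg_right h2 (by positivity)
      _ ≤ 6 * C * N * Real.log (B : ℝ) ^ 2 := mul_le_mul_of_nonneg_left h1 (by positivity)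
  have hN₁le : (N₁ : ℝ) ≤ N / Real.log (N : ℝ) ^ 2 := by
    rw [le_div_iff₀ (by positivity)]
    exact hNs
  have hmono' : ((((Finset.range N).filter p).card : ℕ) : ℝ) ≤
      ((((Finset.range B).filter p).card : ℕ) : ℝ) := by
    exact_mod_cast hmono
  have e : (6 * C + 1) * (N : ℝ) / Real.log (N : ℝ) ^ 2 =
      6 * C * N / Real.log (N : ℝ) ^ 2 + N / Real.log (N : ℝ) ^ 2 := by
    ring
  rw [e]
  linarith [hK]

open Classical in
/-- **RH ⟹ `#{n < N : λ_{n+1} < λ_n} ≤ C·N/(log N)²` for all large `N`** (the cumulative DESCENT COUNTING LAW). -/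
theorem card_liDescent_le_of_rh (hRH : RiemannHypothesis) :
    ∃ C : ℝ, 0 ≤ C ∧ ∀ᶠ N : ℕ in atTop,
      ((((Finset.range N).filter
          (fun n ↦ n ∈ {n : ℕ | keiperLiCoeff (n + 1) < keiperLiCoeff n})).card : ℕ) : ℝ)
        ≤ C * N / Real.log N ^ 2 := by
  obtain ⟨C, hC0, N₀, hblk⟩ := card_liDescent_block_le_of_rh hRH
  exact ⟨6 * C + 1, by positivity,
    cumulative_of_dyadic (fun n ↦ n ∈ {n : ℕ | keiperLiCoeff (n + 1) < keiperLiCoeff n}) hC0 hblk⟩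

end Summit.RiemannHypothesis.RiemannHypothesis.Theorems.Splittings.LiDescentCountingLaw
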